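import Literature.MathematicalPhysics.QuantumLattice.HubbardAtomicLimit
import Literature.MathematicalPhysics.QuantumLattice.FermionTraceFactorization
import Literature.MathematicalPhysics.QuantumLattice.FermionEmbedding
import HarnessLib

/-!
# The Hubbard Gibbs factor as a function of the bond couplings: locality, factorisation, volume independence

Algebraic groundwork for the polymer (cluster) expansion of the Hubbard model around the atomic
limit (Ueltschi 1999, §2.3 and §3). With complex parameters `β, U, μ` and an arbitrary complex
coupling `c_b` on every **bond** `b = (x, y, σ)` (hopping term `T_b = c†_{xσ} c_{yσ}`,
`bondOp`), the generalised Gibbs factor is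

  `Zc(β, U, μ; c) = Tr exp ( -β V_Λ + Σ_b c_b T_b )`,  `V_Λ = Σ_x (U n_{x↑} n_{x↓} - μ (n_{x↑} + n_{x↓}))`

(`Zc`, `onSiteOp`, `onSiteSum`, `hopSum`); the grand-canonical partition function of
`hamiltonianWith G t U μ` is `Zc` at the coupling `c = βt · 1_{bonds of G}`
(`partitionFn_hamiltonianWith_eq_Zc`), and `Zc(c = 0) = z₀^{|Λ|}` is the atomic limit
(`Zc_zero`). PROVED here:

* locality: `T_b`, `V_A = Σ_{x ∈ A} (…)` and `Σ_b c_b T_b` (for `c` supported on bonds inside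
  `A`) lie in the EVEN CAR subalgebra of the orbitals of `A` (`bondOp_mem`, `onSiteSum_mem`,
  `hopSum_mem`);
* the partial atomic traces `Tr_Λ exp(-β V_A) = z₀^{|A|} 4^{|Λ| - |A|}` (`trace_exp_neg_onSiteSum`);
* **factorisation** (Ueltschi's "factorization property of quantum interactions", §2.1, in trace
  form): if `c₁, c₂` are supported on bonds inside disjoint site sets, then
  `Zc(c₁ + c₂) · Zc(0) = Zc(c₁) · Zc(c₂)` (`Zc_add_mul_Zc_zero`) — from graded commutativity and
  the product property of the trace over disjoint CAR subalgebras
  (`FermionTraceFactorization`);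
* **volume independence**: along an order embedding of site sets `e : Λ ↪o Λ'`,
  `Zc_{Λ'}(e_* c) · z₀^{|Λ|} = Zc_Λ(c) · z₀^{|Λ'|}` (`Zc_extend_mul`), by second quantisation of
  `e` (`FermionEmbedding.jwEmbed`) and the factorisation over the image and its complement.

These are the inputs of the polymer representation (`HubbardPolymerRepresentation.lean`) and of
the bounds on the polymer weights (`HubbardPolymerBounds.lean`).

## Mathlib / tree search

Tree: `hamiltonianWith_eq_hoppingForm_add_diagonal`, `onSite_eq_diagonal`, `onSiteEnergy`,
`atomicPartitionFn`, `partitionFn_hamiltonianWith_zero_hopping` (`HubbardAtomicLimit`);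
`carEvenSubalgebra`, `commute_of_mem_carEvenSubalgebra`, `trace_mul_mul_of_mem_carSubalgebra`,
`exp_mem_subalgebra` (`FermionTraceFactorization`); `jwEmbed`, `trace_exp_jwEmbed`
(`FermionEmbedding`); `numberAt_eq_diagonal`, `configEquiv`. Mathlib: `Matrix.exp_add_of_commute`,
`Matrix.exp_diagonal`, `Fintype.prod_add`, `Function.extend`.

## References

* D. Ueltschi, J. Stat. Phys. 95 (1999) 693, §2.1 (factorization property), §2.3 (polymer
  weights), §3 (Hubbard bonds `(⟨x,y⟩, σ)`, `T_𝐀 = c†_{xσ} c_{yσ}`). [Ueltschi1999]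
* O. Bratteli, D. W. Robinson, *Operator Algebras and QSM II*, §5.2.2. [BratteliRobinsonII1997]
-/

noncomputable section

namespace Literature.MathematicalPhysics.QuantumLattice

open Matrix Finset HubbardWave0
open scoped BigOperators

/-! ### Bonds, hopping terms, on-site terms -/

section Defs

variable {Λ : Type*} [LinearOrder Λ] [Fintype Λ]

/-- A **bond** of the Hubbard model: an ordered pair of sites and a spin, `b = (x, y, σ)`,
indexing the hopping term `c†_{xσ} c_{yσ}` (Ueltschi's `𝐀 = (⟨x,y⟩, σ)`; all pairs are allowed
here, the graph enters through the couplings). [cite: Ueltschi1999, §3 (bonds 𝐀 = (⟨x,y⟩,σ))] -/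
abbrev Bond (Λ : Type*) : Type _ := Λ × Λ × Fin 2

/-- The (at most two) sites of a bond. [cite: Ueltschi1999, §3] -/
def Bond.verts [DecidableEq Λ] (b : Bond Λ) : Finset Λ := {b.1, b.2.1}

/-- The hopping term of the bond `b = (x, y, σ)`: `T_b = c†_{xσ} c_{yσ}`. [cite: Ueltschi1999, §3 (T_𝐀 = c†_{xσ}c_{yσ})] -/
def bondOp (b : Bond Λ) : Matrix (Finset (Orb Λ)) (Finset (Orb Λ)) ℂ :=
  creation (orb b.1 b.2.2) * annihilation (orb b.2.1 b.2.2)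

/-- The hopping operator with complex bond couplings `c`: `Σ_b c_b T_b`. [cite: Ueltschi1999, §2.1 (quantum interaction T = (T_A))] -/
def hopSum (c : Bond Λ → ℂ) : Matrix (Finset (Orb Λ)) (Finset (Orb Λ)) ℂ :=
  ∑ b : Bond Λ, c b • bondOp b

/-- The on-site term at `x`: `U n_{x↑} n_{x↓} - μ (n_{x↑} + n_{x↓})` (complex `U, μ`). [cite: Ueltschi1999, §2.1 (local interaction V_x) and §3] -/
def onSiteOp (U μ : ℂ) (x : Λ) : Matrix (Finset (Orb Λ)) (Finset (Orb Λ)) ℂ :=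
  U • (numberOp x 0 * numberOp x 1) - μ • (numberOp x 0 + numberOp x 1)

/-- The on-site operator of a set of sites: `V_A = Σ_{x ∈ A} V_x`. [cite: Ueltschi1999, §2.3 (Σ_{x ∈ 𝒜} V_x)] -/
def onSiteSum (U μ : ℂ) (A : Finset Λ) : Matrix (Finset (Orb Λ)) (Finset (Orb Λ)) ℂ :=
  ∑ x ∈ A, onSiteOp U μ x

end Defs

section Orbs

variable {Λ : Type*}

/-- The orbitals `A × {↑, ↓}` of a set of sites. [folklore] -/
def orbs (A : Finset Λ) : Finset (Orb Λ) := (A ×ˢ (Finset.univ : Finset (Fin 2))).map toLex.toEmbedding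

/-- Membership in `orbs`. [folklore] -/
@[simp] theorem orb_mem_orbs {A : Finset Λ} {x : Λ} {σ : Fin 2} : orb x σ ∈ orbs A ↔ x ∈ A := by
  simp [orbs, orb]

/-- Membership in `orbs`, general form. [folklore] -/
theorem mem_orbs {A : Finset Λ} {i : Orb Λ} : i ∈ orbs A ↔ (ofLex i).1 ∈ A := by
  rw [show i = orb (ofLex i).1 (ofLex i).2 from rfl]
  exact orb_mem_orbs

/-- Disjoint site sets have disjoint orbital sets. [folklore] -/
theorem disjoint_orbs {A B : Finset Λ} (h : Disjoint A B) : Disjoint (orbs A) (orbs B) := by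
  rw [Finset.disjoint_left] at h ⊢
  intro i hi hi'
  exact h (mem_orbs.1 hi) (mem_orbs.1 hi')

/-- `orbs` is monotone. [folklore] -/
theorem orbs_mono {A B : Finset Λ} (h : A ⊆ B) : orbs A ⊆ orbs B := fun _ hi =>
  mem_orbs.2 (h (mem_orbs.1 hi))

end Orbs

section Local

variable {Λ : Type*} [LinearOrder Λ] [Fintype Λ]

/-! ### Locality: membership in the even CAR subalgebras -/

/-- `T_b` is an even local operator of the sites of `b`. [cite: BratteliRobinsonII1997, §5.2.2 (even subalgebra)] -/
theorem bondOp_mem {A : Finset Λ} {b : Bond Λ} (h1 : b.1 ∈ A) (h2 : b.2.1 ∈ A) :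
    bondOp b ∈ carEvenSubalgebra (orbs A) :=
  creation_mul_annihilation_mem_carEvenSubalgebra (orb_mem_orbs.2 h1) (orb_mem_orbs.2 h2)

/-- `n_{xσ}` is an even local operator of `x`. [cite: BratteliRobinsonII1997, §5.2.2 (even subalgebra)] -/
theorem numberOp_mem {A : Finset Λ} {x : Λ} (hx : x ∈ A) (σ : Fin 2) :
    numberOp x σ ∈ carEvenSubalgebra (orbs A) :=
  creation_mul_annihilation_mem_carEvenSubalgebra (orb_mem_orbs.2 hx) (orb_mem_orbs.2 hx)

/-- `V_x` is an even local operator of `x`. [cite: BratteliRobinsonII1997, §5.2.2 (even subalgebra)] -/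
theorem onSiteOp_mem (U μ : ℂ) {A : Finset Λ} {x : Λ} (hx : x ∈ A) :
    onSiteOp U μ x ∈ carEvenSubalgebra (orbs A) :=
  Subalgebra.sub_mem _ (Subalgebra.smul_mem _ (Subalgebra.mul_mem _ (numberOp_mem hx 0) (numberOp_mem hx 1)) _)
    (Subalgebra.smul_mem _ (Subalgebra.add_mem _ (numberOp_mem hx 0) (numberOp_mem hx 1)) _)

/-- `V_A` is an even local operator of `A`. [cite: BratteliRobinsonII1997, §5.2.2 (even subalgebra)] -/
theorem onSiteSum_mem (U μ : ℂ) {A B : Finset Λ} (h : A ⊆ B) :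
    onSiteSum U μ A ∈ carEvenSubalgebra (orbs B) :=
  Subalgebra.sum_mem _ fun _ hx => onSiteOp_mem U μ (h hx)

/-- `Σ_b c_b T_b` is an even local operator of `A` if `c` is supported on bonds inside `A`.
[cite: BratteliRobinsonII1997, §5.2.2 (even subalgebra)] -/
theorem hopSum_mem {A : Finset Λ} {c : Bond Λ → ℂ} (hc : ∀ b, c b ≠ 0 → b.1 ∈ A ∧ b.2.1 ∈ A) :
    hopSum c ∈ carEvenSubalgebra (orbs A) := by
  refine Subalgebra.sum_mem _ fun b _ => ?_
  by_cases hb : c b = 0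
  · rw [hb, zero_smul]; exact Subalgebra.zero_mem _
  · exact Subalgebra.smul_mem _ (bondOp_mem (hc b hb).1 (hc b hb).2) _

/-! ### Linearity of the hopping operator in the couplings -/

/-- `hopSum` is additive. [folklore] -/
theorem hopSum_add (c₁ c₂ : Bond Λ → ℂ) : hopSum (c₁ + c₂) = hopSum c₁ + hopSum c₂ := by
  simp only [hopSum, Pi.add_apply, add_smul, Finset.sum_add_distrib]

/-- `hopSum 0 = 0`. [folklore] -/
@[simp] theorem hopSum_zero : hopSum (0 : Bond Λ → ℂ) = 0 := by
  simp [hopSum]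

/-! ### The on-site operators are diagonal -/

/-- The eigenvalue of `V_x` on the basis state `|s⟩`. [cite: Ueltschi1999, §3 (on-site energies)] -/
def onSiteEnergyAt (U μ : ℂ) (x : Λ) (s : Finset (Orb Λ)) : ℂ :=
  U * (if orb x 0 ∈ s ∧ orb x 1 ∈ s then 1 else 0) -
    μ * ((if orb x 0 ∈ s then 1 else 0) + (if orb x 1 ∈ s then 1 else 0))

/-- `V_x` is diagonal in the occupation basis. [cite: Ueltschi1999, §2.1 (V is a local, i.e. on-site, interaction)] -/
theorem onSiteOp_eq_diagonal (U μ : ℂ) (x : Λ) :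
    onSiteOp U μ x = diagonal (onSiteEnergyAt U μ x) := by
  have hn : ∀ σ : Fin 2, (numberOp x σ : Matrix (Finset (Orb Λ)) (Finset (Orb Λ)) ℂ) =
      diagonal fun s => if orb x σ ∈ s then (1 : ℂ) else 0 := fun σ => by
    rw [numberOp, ← numberAt, numberAt_eq_diagonal]
  rw [onSiteOp, numberOp_mul_numberOp_eq_diagonal, hn 0, hn 1]
  ext s t
  by_cases hst : s = t
  · subst hst
    simp [onSiteEnergyAt]
  · simp [hst]

/-- `V_A` is diagonal with eigenvalue `Σ_{x ∈ A} v_x(s)`. [cite: Ueltschi1999, §2.1] -/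
theorem onSiteSum_eq_diagonal (U μ : ℂ) (A : Finset Λ) :
    onSiteSum U μ A = diagonal fun s => ∑ x ∈ A, onSiteEnergyAt U μ x s := by
  unfold onSiteSum
  rw [Finset.sum_congr rfl fun x _ => onSiteOp_eq_diagonal U μ x]
  ext s t
  simp only [Matrix.sum_apply, diagonal_apply]
  by_cases h : s = t
  · simp [h]
  · simp [h]

/-- The total on-site operator is the tree's `diagonal (onSiteEnergy U μ)`. [cite: Ueltschi1999, §3] -/
theorem onSiteSum_univ (U μ : ℂ) :
    onSiteSum U μ (Finset.univ : Finset Λ) = diagonal (onSiteEnergy U μ) := by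
  rw [← onSite_eq_diagonal, onSiteSum]
  simp only [onSiteOp, Finset.sum_sub_distrib, ← Finset.smul_sum, totalNumber]
  congr 2
  refine Finset.sum_congr rfl fun x _ => ?_
  rw [Fin.sum_univ_two]

end Local

/-! ### Partial atomic traces -/

section AtomicTraces

variable {Λ : Type*} [LinearOrder Λ] [Fintype Λ]

omit [LinearOrder Λ] in
/-- **Site-by-site factorisation of configuration sums** with a site-dependent table:
`Σ_{α, β ⊆ Λ} Π_x φ_x(x ∈ α, x ∈ β) = Π_x (φ_x(1,1) + φ_x(1,0) + φ_x(0,1) + φ_x(0,0))`.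
[cite: Ueltschi1999, §2.1 (e^{-βV} factorises over sites)] -/
theorem sum_sum_prod_eq_prod {R : Type*} [CommSemiring R] [DecidableEq Λ] (φ : Λ → Bool → Bool → R) :
    (∑ α : Finset Λ, ∑ β : Finset Λ, ∏ x, φ x (decide (x ∈ α)) (decide (x ∈ β))) =
      ∏ x, (φ x true true + φ x true false + φ x false true + φ x false false) := by
  -- one binary degree of freedom per site
  have key : ∀ f g : Λ → R, (∑ β : Finset Λ, ∏ x, if x ∈ β then f x else g x) = ∏ x, (f x + g x) := by
    intro f g
    rw [Fintype.prod_add]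
    refine Finset.sum_congr rfl fun β _ => ?_
    rw [Finset.prod_ite]
    congr 1
    · congr 1; ext x; simp
    · congr 1; ext x; simp [Finset.mem_compl]
  have inner : ∀ α : Finset Λ, (∑ β : Finset Λ, ∏ x, φ x (decide (x ∈ α)) (decide (x ∈ β))) =
      ∏ x, (φ x (decide (x ∈ α)) true + φ x (decide (x ∈ α)) false) := by
    intro α
    rw [← key]
    refine Finset.sum_congr rfl fun β _ => Finset.prod_congr rfl fun x _ => ?_
    by_cases hx : x ∈ β <;> simp [hx]
  simp_rw [inner]
  calc (∑ α : Finset Λ, ∏ x, (φ x (decide (x ∈ α)) true + φ x (decide (x ∈ α)) false))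
      = ∑ α : Finset Λ, ∏ x, (if x ∈ α then φ x true true + φ x true false
          else φ x false true + φ x false false) := by
        refine Finset.sum_congr rfl fun α _ => Finset.prod_congr rfl fun x _ => ?_
        by_cases hx : x ∈ α <;> simp [hx]
    _ = ∏ x, ((φ x true true + φ x true false) + (φ x false true + φ x false false)) := key _ _
    _ = ∏ x, (φ x true true + φ x true false + φ x false true + φ x false false) :=
        Finset.prod_congr rfl fun x _ => by rw [← add_assoc]

/-- The Boltzmann factor of `|s⟩` for the on-site operator of `A` is a product over the sites of
`A` of the one-site table. [cite: Ueltschi1999, §2.3 (per-site factorisation of e^{-τ Σ_{x∈𝒜} V_x})] -/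
theorem exp_neg_sum_onSiteEnergyAt (β U μ : ℂ) (A : Finset Λ) (s : Finset (Orb Λ)) :
    Complex.exp (-(β * ∑ x ∈ A, onSiteEnergyAt U μ x s)) =
      ∏ x, if x ∈ A then atomicBoltzmannTable β U μ (decide (x ∈ upPart s)) (decide (x ∈ downPart s)) else 1 := by
  rw [Finset.mul_sum, ← Finset.sum_neg_distrib, Complex.exp_sum, ← Finset.prod_filter, Finset.filter_mem_eq_inter,
    Finset.univ_inter]
  refine Finset.prod_congr rfl fun x _ => ?_
  simp only [onSiteEnergyAt, mem_upPart, mem_downPart]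
  by_cases hu : orb x 0 ∈ s
  · by_cases hd : orb x 1 ∈ s
    · simp only [hu, hd, and_self, if_true, atomicBoltzmannTable, decide_true]
      ring_nf
    · simp [hu, hd, atomicBoltzmannTable]
  · by_cases hd : orb x 1 ∈ s
    · simp [hu, hd, atomicBoltzmannTable]
    · simp [hu, hd, atomicBoltzmannTable]

/-- **Partial atomic trace**: over the Fock space of `Λ`,
`Tr exp(-β V_A) = z₀(β, U, μ)^{|A|} · 4^{|Λ| - |A|}`. [cite: Ueltschi1999, §3 (f₀ = -β⁻¹ log z₀, a one-site quantity)] -/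
theorem trace_exp_neg_onSiteSum (β U μ : ℂ) (A : Finset Λ) :
    (NormedSpace.exp (-(β • onSiteSum U μ A))).trace =
      atomicPartitionFn β U μ ^ A.card * 4 ^ (Fintype.card Λ - A.card) := by
  classical
  rw [onSiteSum_eq_diagonal, show (-(β • diagonal fun s : Finset (Orb Λ) => ∑ x ∈ A, onSiteEnergyAt U μ x s)) =
      diagonal (fun s => -(β * ∑ x ∈ A, onSiteEnergyAt U μ x s)) by
    rw [← diagonal_smul, ← diagonal_neg]; rfl]
  rw [Matrix.exp_diagonal, trace_diagonal]
  simp only [Pi.coe_exp, ← Complex.exp_eq_exp_ℂ]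
  simp_rw [exp_neg_sum_onSiteEnergyAt]
  have h1 : (∑ s : Finset (Orb Λ), ∏ x, if x ∈ A then
      atomicBoltzmannTable β U μ (decide (x ∈ upPart s)) (decide (x ∈ downPart s)) else 1) =
      ∑ p : Finset Λ × Finset Λ, ∏ x, if x ∈ A then
        atomicBoltzmannTable β U μ (decide (x ∈ upPart (configEquiv.symm p))) (decide (x ∈ downPart (configEquiv.symm p)))
        else 1 := (configEquiv.symm.sum_comp _).symm
  rw [h1, Fintype.sum_prod_type]
  simp only [configEquiv, Equiv.coe_fn_symm_mk, upPart_pairSet, downPart_pairSet]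
  rw [sum_sum_prod_eq_prod (fun x b b' => if x ∈ A then atomicBoltzmannTable β U μ b b' else 1)]
  have hsite : ∀ x : Λ, ((if x ∈ A then atomicBoltzmannTable β U μ true true else 1) +
      (if x ∈ A then atomicBoltzmannTable β U μ true false else 1) +
      (if x ∈ A then atomicBoltzmannTable β U μ false true else 1) +
      (if x ∈ A then atomicBoltzmannTable β U μ false false else 1)) =
      if x ∈ A then atomicPartitionFn β U μ else 4 := by
    intro x
    by_cases hx : x ∈ A
    · simp only [if_pos hx, atomicBoltzmannTable, atomicPartitionFn]; ring
    · simp only [if_neg hx]; norm_num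
  rw [Finset.prod_congr rfl fun x _ => hsite x, Finset.prod_ite, Finset.prod_const, Finset.prod_const,
    Finset.filter_mem_eq_inter, Finset.univ_inter]
  congr 2
  rw [Finset.filter_not, Finset.filter_mem_eq_inter, Finset.univ_inter, Finset.card_univ_sdiff]

end AtomicTraces

/-! ### The generalised Gibbs factor and its factorisation -/

section Gibbs

variable {Λ : Type*} [LinearOrder Λ] [Fintype Λ]

/-- **The generalised Gibbs factor** `Zc(β, U, μ; c) = Tr exp(-β V_Λ + Σ_b c_b T_b)` with an
arbitrary complex coupling on every bond (for the Hubbard model, `c = βt` on the bonds of the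
graph and `0` elsewhere, `partitionFn_hamiltonianWith_eq_Zc`). [cite: Ueltschi1999, §2.3 (Tr e^{-βH_Λ}, H = V + T)] -/
def Zc (β U μ : ℂ) (c : Bond Λ → ℂ) : ℂ :=
  (NormedSpace.exp (-(β • onSiteSum U μ (Finset.univ : Finset Λ)) + hopSum c)).trace

/-- **The atomic limit**: `Zc(c = 0) = z₀^{|Λ|}`. [cite: Ueltschi1999, §3 (f₀(β,μ) = -β⁻¹ log z₀)] -/
theorem Zc_zero (β U μ : ℂ) : Zc β U μ (0 : Bond Λ → ℂ) = atomicPartitionFn β U μ ^ Fintype.card Λ := by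
  rw [Zc, hopSum_zero, add_zero, trace_exp_neg_onSiteSum, Finset.card_univ, Nat.sub_self, pow_zero, mul_one]

/-- `V` over a disjoint union. [folklore] -/
theorem onSiteSum_union (U μ : ℂ) {A B : Finset Λ} (h : Disjoint A B) :
    onSiteSum U μ (A ∪ B) = onSiteSum U μ A + onSiteSum U μ B := by
  unfold onSiteSum; rw [Finset.sum_union h]

/-- **Three-fold factorisation of traces of exponentials of commuting even local operators.**
[cite: Ueltschi1999, §2.1 (factorization property of quantum interactions)] -/
theorem trace_exp_add_add_mul {S₁ S₂ S₃ : Finset (Orb Λ)} {X₁ X₂ X₃ : Matrix (Finset (Orb Λ)) (Finset (Orb Λ)) ℂ}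
    (h₁ : X₁ ∈ carEvenSubalgebra S₁) (h₂ : X₂ ∈ carEvenSubalgebra S₂) (h₃ : X₃ ∈ carEvenSubalgebra S₃)
    (h12 : Disjoint S₁ S₂) (h13 : Disjoint S₁ S₃) (h23 : Disjoint S₂ S₃) :
    (NormedSpace.exp (X₁ + X₂ + X₃)).trace * (2 ^ Fintype.card (Orb Λ)) ^ 2 =
      (NormedSpace.exp X₁).trace * (NormedSpace.exp X₂).trace * (NormedSpace.exp X₃).trace := by
  have h₁' := carEvenSubalgebra_le_carSubalgebra _ h₁
  have h₂' := carEvenSubalgebra_le_carSubalgebra _ h₂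
  have h₃' := carEvenSubalgebra_le_carSubalgebra _ h₃
  have hc12 : Commute X₁ X₂ := commute_of_mem_carEvenSubalgebra h₁ h₂' h12
  have hc123 : Commute (X₁ + X₂) X₃ :=
    (commute_of_mem_carEvenSubalgebra h₁ h₃' h13).add_left (commute_of_mem_carEvenSubalgebra h₂ h₃' h23)
  rw [Matrix.exp_add_of_commute _ _ hc123, Matrix.exp_add_of_commute _ _ hc12]
  exact trace_mul_mul_of_mem_carSubalgebra (exp_mem_subalgebra _ h₁') (exp_mem_subalgebra _ h₂')
    (exp_mem_subalgebra _ h₃') h12 h13 h23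

/-- Cross-multiplication bookkeeping for the factorisation. [folklore] -/
private theorem cross_mul_aux {a d b₁ b₂ x₁ x₂ y₁ y₂ τ N : ℂ} (hN : N ≠ 0) (f12 : a * N = x₁ * x₂ * τ)
    (f0 : d * N = y₁ * y₂ * τ) (f1 : b₁ * N = x₁ * y₂ * τ) (f2 : b₂ * N = y₁ * x₂ * τ) :
    a * d = b₁ * b₂ := by
  apply mul_right_cancel₀ (mul_ne_zero hN hN)
  calc a * d * (N * N) = (a * N) * (d * N) := by ring
    _ = (x₁ * x₂ * τ) * (y₁ * y₂ * τ) := by rw [f12, f0]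
    _ = (x₁ * y₂ * τ) * (y₁ * x₂ * τ) := by ring
    _ = (b₁ * N) * (b₂ * N) := by rw [f1, f2]
    _ = b₁ * b₂ * (N * N) := by ring

/-- **Factorisation of the Gibbs factor** (Ueltschi's factorization property, §2.1, in trace
form): if the couplings `c₁`, `c₂` live on bonds inside disjoint site sets `A₁`, `A₂`, then
`Zc(c₁ + c₂) · Zc(0) = Zc(c₁) · Zc(c₂)`. [cite: Ueltschi1999, §2.1 (factorization property) and §2.3] -/
theorem Zc_add_mul_Zc_zero (β U μ : ℂ) {A₁ A₂ : Finset Λ} (hA : Disjoint A₁ A₂) {c₁ c₂ : Bond Λ → ℂ}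
    (hc₁ : ∀ b, c₁ b ≠ 0 → b.1 ∈ A₁ ∧ b.2.1 ∈ A₁) (hc₂ : ∀ b, c₂ b ≠ 0 → b.1 ∈ A₂ ∧ b.2.1 ∈ A₂) :
    Zc β U μ (c₁ + c₂) * Zc β U μ (0 : Bond Λ → ℂ) = Zc β U μ c₁ * Zc β U μ c₂ := by
  set A₃ : Finset Λ := (A₁ ∪ A₂)ᶜ with hA₃
  have h13 : Disjoint A₁ A₃ := Finset.disjoint_left.2 fun x hx hx' =>
    (Finset.mem_compl.1 hx') (Finset.mem_union_left _ hx)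
  have h23 : Disjoint A₂ A₃ := Finset.disjoint_left.2 fun x hx hx' =>
    (Finset.mem_compl.1 hx') (Finset.mem_union_right _ hx)
  have hV : onSiteSum U μ (Finset.univ : Finset Λ) = onSiteSum U μ A₁ + onSiteSum U μ A₂ + onSiteSum U μ A₃ := by
    rw [← Finset.union_compl (A₁ ∪ A₂), onSiteSum_union U μ disjoint_compl_right, onSiteSum_union U μ hA]
  have d12 := disjoint_orbs hA
  have d13 := disjoint_orbs h13
  have d23 := disjoint_orbs h23
  -- the local pieces
  have mV : ∀ A : Finset Λ, -(β • onSiteSum U μ A) ∈ carEvenSubalgebra (orbs A) := fun A =>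
    Subalgebra.neg_mem _ (Subalgebra.smul_mem _ (onSiteSum_mem U μ subset_rfl) _)
  have m1 : -(β • onSiteSum U μ A₁) + hopSum c₁ ∈ carEvenSubalgebra (orbs A₁) :=
    Subalgebra.add_mem _ (mV A₁) (hopSum_mem hc₁)
  have m2 : -(β • onSiteSum U μ A₂) + hopSum c₂ ∈ carEvenSubalgebra (orbs A₂) :=
    Subalgebra.add_mem _ (mV A₂) (hopSum_mem hc₂)
  have key : ∀ P₁ P₂ : Matrix (Finset (Orb Λ)) (Finset (Orb Λ)) ℂ, P₁ ∈ carEvenSubalgebra (orbs A₁) →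
      P₂ ∈ carEvenSubalgebra (orbs A₂) →
      (NormedSpace.exp (P₁ + P₂ + -(β • onSiteSum U μ A₃))).trace * (2 ^ Fintype.card (Orb Λ)) ^ 2 =
        (NormedSpace.exp P₁).trace * (NormedSpace.exp P₂).trace *
          (NormedSpace.exp (-(β • onSiteSum U μ A₃))).trace :=
    fun P₁ P₂ h₁ h₂ => trace_exp_add_add_mul h₁ h₂ (mV A₃) d12 d13 d23
  -- the four Gibbs factors
  have e12 : Zc β U μ (c₁ + c₂) = (NormedSpace.exp ((-(β • onSiteSum U μ A₁) + hopSum c₁) +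
      (-(β • onSiteSum U μ A₂) + hopSum c₂) + -(β • onSiteSum U μ A₃))).trace := by
    rw [Zc, hV, hopSum_add]; congr 2; simp only [smul_add, neg_add]; abel
  have e0 : Zc β U μ (0 : Bond Λ → ℂ) = (NormedSpace.exp (-(β • onSiteSum U μ A₁) +
      -(β • onSiteSum U μ A₂) + -(β • onSiteSum U μ A₃))).trace := by
    rw [Zc, hV, hopSum_zero, add_zero]; congr 2; simp only [smul_add, neg_add]
  have e1 : Zc β U μ c₁ = (NormedSpace.exp ((-(β • onSiteSum U μ A₁) + hopSum c₁) +
      -(β • onSiteSum U μ A₂) + -(β • onSiteSum U μ A₃))).trace := by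
    rw [Zc, hV]; congr 2; simp only [smul_add, neg_add]; abel
  have e2 : Zc β U μ c₂ = (NormedSpace.exp (-(β • onSiteSum U μ A₁) +
      (-(β • onSiteSum U μ A₂) + hopSum c₂) + -(β • onSiteSum U μ A₃))).trace := by
    rw [Zc, hV]; congr 2; simp only [smul_add, neg_add]; abel
  rw [e12, e0, e1, e2]
  exact cross_mul_aux (pow_ne_zero _ (pow_ne_zero _ two_ne_zero)) (key _ _ m1 m2) (key _ _ (mV A₁) (mV A₂))
    (key _ _ m1 (mV A₂)) (key _ _ (mV A₁) m2)

/-! ### The Hubbard partition function as a Gibbs factor -/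

/-- The Hubbard couplings: `τ` on the (ordered) bonds of the graph `G`, `0` elsewhere. [cite: Ueltschi1999, §3 (T = -t Σ_𝐀 T_𝐀)] -/
def hubbardCoupling (G : SimpleGraph Λ) [DecidableRel G.Adj] (τ : ℂ) : Bond Λ → ℂ :=
  fun b => if G.Adj b.1 b.2.1 then τ else 0

omit [LinearOrder Λ] [Fintype Λ] in
/-- `hubbardCoupling` unfolded. [folklore] -/
theorem hubbardCoupling_apply (G : SimpleGraph Λ) [DecidableRel G.Adj] (τ : ℂ) (b : Bond Λ) :
    hubbardCoupling G τ b = if G.Adj b.1 b.2.1 then τ else 0 := rfl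

/-- The hopping operator of the Hubbard couplings is `τ · hoppingForm G 1`. [cite: Ueltschi1999, §3] -/
theorem hopSum_hubbardCoupling (G : SimpleGraph Λ) [DecidableRel G.Adj] (τ : ℂ) :
    hopSum (hubbardCoupling G τ) = τ • hoppingForm G (fun _ _ => 1) := by
  rw [hoppingForm_one, hopSum, Finset.smul_sum, Fintype.sum_prod_type]
  refine Finset.sum_congr rfl fun u _ => ?_
  rw [Finset.smul_sum, Fintype.sum_prod_type]
  refine Finset.sum_congr rfl fun v _ => ?_
  rw [Finset.smul_sum]
  refine Finset.sum_congr rfl fun σ _ => ?_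
  simp only [hubbardCoupling, bondOp]
  split_ifs <;> simp

/-- **The grand-canonical Hubbard partition function is the Gibbs factor at the Hubbard
couplings**: `Z_β(H(t,U) - μN) = Zc(β, U, μ; βt · 1_{bonds of G})` (real parameters).
[cite: Ueltschi1999, §3 (the Hubbard Hamiltonian H = V + T)] -/
theorem partitionFn_hamiltonianWith_eq_Zc (G : SimpleGraph Λ) [DecidableRel G.Adj] (β t U μ : ℝ) :
    Matrix.partitionFn β (hamiltonianWith G t U μ) =
      Zc (β : ℂ) (U : ℂ) (μ : ℂ) (hubbardCoupling G ((β : ℂ) * (t : ℂ))) := by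
  unfold Matrix.partitionFn Matrix.gibbsWeight Zc
  rw [hamiltonianWith_eq_hoppingForm_add_diagonal, hopSum_hubbardCoupling, onSiteSum_univ, smul_add, smul_smul,
    neg_mul_neg, neg_smul, add_comm]

end Gibbs

/-! ### Volume independence along order embeddings of site sets -/

section Embedding

variable {Λ Λ' : Type*} [LinearOrder Λ] [Fintype Λ] [LinearOrder Λ'] [Fintype Λ']

/-- The orbital embedding `(x, σ) ↦ (e x, σ)` induced by an order embedding of site sets (an order
embedding for the lexicographic orders). [folklore] -/
def orbEmb (e : Λ ↪o Λ') : Orb Λ ↪o Orb Λ' :=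
  OrderEmbedding.ofStrictMono (fun i => orb (e (ofLex i).1) (ofLex i).2) (by
    intro i j hij
    rcases Prod.Lex.lt_iff.1 hij with h | ⟨h1, h2⟩
    · exact Prod.Lex.lt_iff.2 (Or.inl (e.strictMono h))
    · exact Prod.Lex.lt_iff.2 (Or.inr ⟨congrArg e h1, h2⟩))

variable (e : Λ ↪o Λ')

omit [Fintype Λ] [Fintype Λ'] in
/-- `orbEmb` on an orbital. [folklore] -/
@[simp] theorem orbEmb_orb (x : Λ) (σ : Fin 2) : orbEmb e (orb x σ) = orb (e x) σ := rfl

/-- The induced map on bonds. [folklore] -/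
def bondMap (b : Bond Λ) : Bond Λ' := (e b.1, e b.2.1, b.2.2)

omit [Fintype Λ] [Fintype Λ'] in
/-- `bondMap` is injective. [folklore] -/
theorem bondMap_injective : Function.Injective (bondMap e) := by
  rintro ⟨x, y, σ⟩ ⟨x', y', σ'⟩ h
  simp only [bondMap, Prod.mk.injEq] at h
  obtain ⟨h1, h2, h3⟩ := h
  rw [e.injective h1, e.injective h2, h3]

/-- Second quantisation of `e` maps `T_b` to `T_{e b}`. [cite: BratteliRobinsonII1997, §5.2.2 (isotony)] -/
theorem jwEmbed_bondOp (b : Bond Λ) : jwEmbed (orbEmb e) (bondOp b) = bondOp (bondMap e b) := by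
  rw [bondOp, map_mul, jwEmbed_creation, jwEmbed_annihilation, orbEmb_orb, orbEmb_orb]; rfl

/-- Second quantisation of `e` maps `n_{xσ}` to `n_{(e x)σ}`. [cite: BratteliRobinsonII1997, §5.2.2 (isotony)] -/
theorem jwEmbed_numberOp (x : Λ) (σ : Fin 2) : jwEmbed (orbEmb e) (numberOp x σ) = numberOp (e x) σ := by
  rw [numberOp, map_mul, jwEmbed_creation, jwEmbed_annihilation, orbEmb_orb]; rfl

/-- Second quantisation of `e` maps `V_x` to `V_{e x}`. [cite: BratteliRobinsonII1997, §5.2.2 (isotony)] -/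
theorem jwEmbed_onSiteOp (U μ : ℂ) (x : Λ) : jwEmbed (orbEmb e) (onSiteOp U μ x) = onSiteOp U μ (e x) := by
  simp only [onSiteOp, map_sub, map_smul, map_mul, map_add, jwEmbed_numberOp]

/-- Second quantisation of `e` maps `V_A` to `V_{e A}`. [cite: BratteliRobinsonII1997, §5.2.2 (isotony)] -/
theorem jwEmbed_onSiteSum (U μ : ℂ) (A : Finset Λ) :
    jwEmbed (orbEmb e) (onSiteSum U μ A) = onSiteSum U μ (A.map e.toEmbedding) := by
  rw [onSiteSum, map_sum, onSiteSum, Finset.sum_map]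
  exact Finset.sum_congr rfl fun x _ => jwEmbed_onSiteOp e U μ x

/-- Second quantisation of `e` maps `Σ_b c_b T_b` to the hopping operator of the couplings
extended by zero to the bonds of `Λ'`. [cite: BratteliRobinsonII1997, §5.2.2 (isotony)] -/
theorem jwEmbed_hopSum (c : Bond Λ → ℂ) :
    jwEmbed (orbEmb e) (hopSum c) = hopSum (Function.extend (bondMap e) c 0) := by
  rw [hopSum, map_sum, hopSum]
  symm
  rw [← Finset.sum_subset (Finset.subset_univ (Finset.univ.map ⟨bondMap e, bondMap_injective e⟩))]
  · rw [Finset.sum_map]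
    refine Finset.sum_congr rfl fun b _ => ?_
    rw [map_smul, jwEmbed_bondOp]
    simp [(bondMap_injective e).extend_apply]
  · intro b' _ hb'
    have h : ¬ ∃ b, bondMap e b = b' := fun ⟨b, hb⟩ => hb' (Finset.mem_map.2 ⟨b, Finset.mem_univ _, hb⟩)
    rw [Function.extend_apply' _ _ _ h, Pi.zero_apply, zero_smul]

omit [Fintype Λ'] in
/-- The extended couplings live on bonds inside the image. [folklore] -/
theorem extend_ne_zero {c : Bond Λ → ℂ} {b' : Bond Λ'} (h : Function.extend (bondMap e) c 0 b' ≠ 0) :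
    b'.1 ∈ (Finset.univ : Finset Λ).map e.toEmbedding ∧ b'.2.1 ∈ (Finset.univ : Finset Λ).map e.toEmbedding := by
  by_cases hb : ∃ b, bondMap e b = b'
  · obtain ⟨b, rfl⟩ := hb
    exact ⟨Finset.mem_map.2 ⟨b.1, Finset.mem_univ _, rfl⟩, Finset.mem_map.2 ⟨b.2.1, Finset.mem_univ _, rfl⟩⟩
  · exact absurd (by rw [Function.extend_apply' _ _ _ hb, Pi.zero_apply]) h

/-- The number of orbitals is twice the number of sites (a `private` copy of `card_orb` of
`HubbardModelParticleHoleProofs.lean`, not imported here). [folklore] -/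
private theorem card_orb_eq (Λ : Type*) [Fintype Λ] : Fintype.card (Orb Λ) = 2 * Fintype.card Λ := by
  simp [Orb, Lex, Fintype.card_prod, mul_comm]

/-- **Volume independence of the Gibbs factor**: along an order embedding of site sets
`e : Λ ↪o Λ'`, the Gibbs factor of `Λ'` at the couplings of `Λ` extended by zero is the Gibbs
factor of `Λ` times the atomic factor of the extra sites:
`Zc_{Λ'}(e_* c) = Zc_Λ(c) · z₀^{|Λ'| - |Λ|}`. [cite: Ueltschi1999, §2.3 (the weight of a polymer only involves its own sites)] -/
theorem Zc_extend (β U μ : ℂ) (c : Bond Λ → ℂ) :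
    Zc β U μ (Function.extend (bondMap e) c 0) =
      Zc β U μ c * atomicPartitionFn β U μ ^ (Fintype.card Λ' - Fintype.card Λ) := by
  set R : Finset Λ' := (Finset.univ : Finset Λ).map e.toEmbedding with hR
  have hRc : Rᶜ.card = Fintype.card Λ' - Fintype.card Λ := by
    rw [Finset.card_compl, hR, Finset.card_map, Finset.card_univ]
  have hle : Fintype.card Λ ≤ Fintype.card Λ' := Fintype.card_le_of_embedding e.toEmbedding
  -- split the on-site operator of `Λ'`
  have hV : onSiteSum U μ (Finset.univ : Finset Λ') = onSiteSum U μ R + onSiteSum U μ Rᶜ := by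
    rw [← Finset.union_compl R, onSiteSum_union U μ disjoint_compl_right]
  set X₁ := -(β • onSiteSum U μ R) + hopSum (Function.extend (bondMap e) c 0) with hX₁
  set X₃ := -(β • onSiteSum U μ Rᶜ) with hX₃
  have hexp : -(β • onSiteSum U μ (Finset.univ : Finset Λ')) + hopSum (Function.extend (bondMap e) c 0) = X₁ + X₃ := by
    rw [hV, smul_add, neg_add, hX₁, hX₃]; abel
  have hX₁e : X₁ = jwEmbed (orbEmb e) (-(β • onSiteSum U μ (Finset.univ : Finset Λ)) + hopSum c) := by
    rw [map_add, map_neg, map_smul, jwEmbed_onSiteSum, jwEmbed_hopSum]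
  have mX₁ : X₁ ∈ carEvenSubalgebra (orbs R) :=
    Subalgebra.add_mem _ (Subalgebra.neg_mem _ (Subalgebra.smul_mem _ (onSiteSum_mem U μ subset_rfl) _))
      (hopSum_mem fun b' hb' => extend_ne_zero e hb')
  have mX₃ : X₃ ∈ carEvenSubalgebra (orbs Rᶜ) :=
    Subalgebra.neg_mem _ (Subalgebra.smul_mem _ (onSiteSum_mem U μ subset_rfl) _)
  have hd : Disjoint (orbs R) (orbs Rᶜ) := disjoint_orbs disjoint_compl_right
  have hcomm : Commute X₁ X₃ :=
    commute_of_mem_carEvenSubalgebra mX₁ (carEvenSubalgebra_le_carSubalgebra _ mX₃) hd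
  have hfac := trace_mul_of_mem_carSubalgebra
    (exp_mem_subalgebra _ (carEvenSubalgebra_le_carSubalgebra _ mX₁))
    (exp_mem_subalgebra _ (carEvenSubalgebra_le_carSubalgebra _ mX₃)) hd
  rw [← Matrix.exp_add_of_commute _ _ hcomm] at hfac
  -- evaluate the pieces
  have h1 : (NormedSpace.exp X₁).trace = 2 ^ (Fintype.card (Orb Λ') - Fintype.card (Orb Λ)) * Zc β U μ c := by
    rw [hX₁e, trace_exp_jwEmbed, Zc]
  have h3 : (NormedSpace.exp X₃).trace =
      atomicPartitionFn β U μ ^ (Fintype.card Λ' - Fintype.card Λ) * 4 ^ Fintype.card Λ := by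
    rw [hX₃, trace_exp_neg_onSiteSum, hRc]
    congr 2
    omega
  rw [Zc, hexp]
  -- cancel the powers of two
  have h2pow : (2 : ℂ) ^ Fintype.card (Orb Λ') = 4 ^ Fintype.card Λ' := by
    rw [card_orb_eq, pow_mul]; norm_num
  have h2pow' : (2 : ℂ) ^ (Fintype.card (Orb Λ') - Fintype.card (Orb Λ)) = 4 ^ (Fintype.card Λ' - Fintype.card Λ) := by
    rw [card_orb_eq, card_orb_eq, ← Nat.mul_sub, pow_mul]; norm_num
  have h4 : (4 : ℂ) ^ Fintype.card Λ' ≠ 0 := pow_ne_zero _ (by norm_num)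
  have hsplit : (4 : ℂ) ^ Fintype.card Λ' = 4 ^ (Fintype.card Λ' - Fintype.card Λ) * 4 ^ Fintype.card Λ := by
    rw [← pow_add, Nat.sub_add_cancel hle]
  have main : (NormedSpace.exp (X₁ + X₃)).trace * 4 ^ Fintype.card Λ' =
      Zc β U μ c * atomicPartitionFn β U μ ^ (Fintype.card Λ' - Fintype.card Λ) * 4 ^ Fintype.card Λ' :=
    calc (NormedSpace.exp (X₁ + X₃)).trace * 4 ^ Fintype.card Λ'
        = (NormedSpace.exp (X₁ + X₃)).trace * 2 ^ Fintype.card (Orb Λ') := by rw [h2pow]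
      _ = (NormedSpace.exp X₁).trace * (NormedSpace.exp X₃).trace := hfac
      _ = (2 ^ (Fintype.card (Orb Λ') - Fintype.card (Orb Λ)) * Zc β U μ c) *
            (atomicPartitionFn β U μ ^ (Fintype.card Λ' - Fintype.card Λ) * 4 ^ Fintype.card Λ) := by rw [h1, h3]
      _ = (4 ^ (Fintype.card Λ' - Fintype.card Λ) * Zc β U μ c) *
            (atomicPartitionFn β U μ ^ (Fintype.card Λ' - Fintype.card Λ) * 4 ^ Fintype.card Λ) := by rw [h2pow']
      _ = Zc β U μ c * atomicPartitionFn β U μ ^ (Fintype.card Λ' - Fintype.card Λ) *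
            (4 ^ (Fintype.card Λ' - Fintype.card Λ) * 4 ^ Fintype.card Λ) := by ring
      _ = Zc β U μ c * atomicPartitionFn β U μ ^ (Fintype.card Λ' - Fintype.card Λ) * 4 ^ Fintype.card Λ' := by
            rw [← hsplit]
  exact mul_right_cancel₀ h4 main

end Embedding

end Literature.MathematicalPhysics.QuantumLattice

end
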